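import Literature.AlgebraicGeometry.Frobenioids.SliceInheritance
import Literature.AnabelianGeometry.EtaleTheta.ThetaFrobenioid

/-!
# [EtTh] §3 discharge: the base category `D_α` of Example 3.9 (iv)

Mochizuki, *The étale theta function and its Frobenioid-theoretic manifestations*, Publ. RIMS **45**
(2009), Example 3.9 (iv), p. 311 (PDF p. 85) [cite: MochizukiEtTh2009, Ex 3.9 p.85]: "`D_α :=
(D_W)_B[α] (⊆ (D_W)_B)` … gives rise to a tempered Frobenioid … of rationally standard type with
perfect divisor monoid over the slim [cf. Remark 3.7.2] base category `D_α` of FSM-type [cf. Remark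
3.7.2]", where
Remark 3.7.2 (p. 306) recalls that "`D₀` is slim [cf. [SemiAnbd], Example 3.10; Remark 3.4.1] and of
FSM-, hence also of FSMFF-, type".  abc-iut cell, layer L2, seat abc-iut-L2-t9 (proof-only companion to
abc-iut-L2-t3's `ThetaFrobenioid.lean`; node EtTh:Ex3.9(iv), base-category clauses).

abc-iut-L2-t3 types `D_α` REALLY as `Example39Data.Dα α = bracketCat (Over.mk α)` (the [EtTh] §0
bracket construction inside Mathlib's `Over B`) over an abstract category `D_W` (":= `B^temp(W^log)⁰`"),
and carries the printed properties of `D_α` as the named fact `Example39_iv_facts`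
(`… ∧ IsSlim (Dα α) ∧ IsOfFSMType (Dα α)`) and as the fields `isConnected`, `isTotallyEpimorphic`
of the hypothesis structure `FrobenioidHyp`.  Print's justification "[cf. Remark 3.7.2]" is a statement about
the categories `B^temp(−)⁰` themselves; the passage from `D_W` to `(D_W)_B[α]` is the silent step,
supplied here from the generic [FrdI] §0 lemmas of `Frobenioids/SliceInheritance.lean`:

* `isConnected_Dα` — `D_α` is connected, OUTRIGHT (every object maps to `α`);
* `isSlim_Dα`, `isOfFSMType_Dα`, `isTotallyEpimorphic_Dα` — `D_α` is slim / of FSM-type / totally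
  epimorphic as soon as `D_W` is;
* `example39_iv_facts_of` — the named fact `Example39_iv_facts` REDUCED to its inputs: rationality of
  `Φ_α^ell` (the theta functions of §1, Prop. 1.4 (i); not touched here) and `D_W` slim and of FSM-type
  (Remark 3.7.2 for `W^log`, i.e. [SemiAnbd] Example 3.10 — cf. `SemiGraphs/TemperoidsSlimProofs.lean`
  for `B^temp(Π)` with `Π` temp-slim);
* `frobenioidHyp_of` — the hypothesis structure `FrobenioidHyp` with its two purely categorical
  fields (`D_α` connected, totally epimorphic) supplied, the divisor-monoid fields kept as inputs.

HONEST FRAMING: nothing here asserts that `D_W = B^temp(W^log)⁰` is slim or of FSM-type (that is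
[SemiAnbd] content over the tempered fundamental group); the rationality clause and the divisorial
clauses of Example 3.9 (iv) are untouched; typed ≠ proved for everything not listed above.
-/

namespace Literature.AnabelianGeometry.EtaleTheta

namespace Example39Data

open CategoryTheory Opposite Literature.AlgebraicGeometry.Frobenioids

universe u v w

variable {DW : Type u} [Category.{v} DW] {A B : DW} (α : A ⟶ B)

/-! ### The purely categorical clauses -/

/-- **`D_α` is connected** ([FrdI] §0; needed as `FrobenioidHyp.isConnected`, Def. 3.6 (ii) "connected,
totally epimorphic category `D`"): every object of `(D_W)_B[α]` admits an arrow to the object `α`, which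
lies in `D_α`.  Unconditional. [cite: MochizukiEtTh2009, Ex 3.9 p.85] -/
theorem isConnected_Dα : IsConnected (Dα α) :=
  isConnected_fullSubcategory_of_hom (admitsMorphismTo_self (Over.mk α)) fun _ h => h

/-- **`D_α` is slim when `D_W` is** ("the slim [cf. Remark 3.7.2] base category `D_α`", p.311 (PDF
p.85)): slices of slim categories are slim, and `(D_W)_B[α] ⊆ (D_W)_B` is a full subcategory closed
under domains of arrows. [cite: MochizukiEtTh2009, Ex 3.9 p.85] -/
theorem isSlim_Dα (hW : IsSlim DW) : IsSlim (Dα α) :=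
  (hW.over B).fullSubcategory fun _ _ f h => admitsMorphismTo_of_hom f h

/-- **`D_α` is of FSM-type when `D_W` is** ("`D_α` of FSM-type [cf. Remark 3.7.2]", p.311 (PDF p.85)).
[cite: MochizukiEtTh2009, Ex 3.9 p.85] -/
theorem isOfFSMType_Dα (hW : IsOfFSMType DW) : IsOfFSMType (Dα α) :=
  (hW.over B).fullSubcategory fun _ _ f h => admitsMorphismTo_of_hom f h

/-- **`D_α` is totally epimorphic when `D_W` is** (Def. 3.6 (ii) asks the base of a tempered
Frobenioid to be "a connected, totally epimorphic category"; `FrobenioidHyp.isTotallyEpimorphic`).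
[cite: MochizukiEtTh2009, Ex 3.9 p.85] -/
theorem isTotallyEpimorphic_Dα (hW : IsTotallyEpimorphic DW) : IsTotallyEpimorphic (Dα α) :=
  (hW.over B).fullSubcategory _

/-! ### Example 3.9 (iv)'s named facts, reduced to their inputs -/

variable {V : FrdIMonoidStub.{w}} {TW : RealifiedDivisorMonoids (D₀ := DW) V}
  (E : Example39Data V DW TW)

/-- **Example 3.9 (iv), "of rationally standard type … over the slim base category `D_α` of FSM-type"**
(abc-iut-L2-t3's named fact `Example39_iv_facts`) HOLDS as soon as `Φ_α^ell` is rational and `D_W` is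
slim and of FSM-type (Remark 3.7.2): the two base-category conjuncts are `isSlim_Dα`, `isOfFSMType_Dα`.
[cite: MochizukiEtTh2009, Ex 3.9 p.85] -/
theorem example39_iv_facts_of {VD : FrdICatStub.{max u v, v, w} (Dα α)} (h : E.FrobenioidHyp α VD)
    (hrat : (E.thetaFrobenioid α h).IsRational) (hslim : IsSlim DW) (hfsm : IsOfFSMType DW) :
    E.Example39_iv_facts α h :=
  ⟨hrat, isSlim_Dα α hslim, isOfFSMType_Dα α hfsm⟩

/-- Conversely the base-category conjuncts of `Example39_iv_facts` are exactly `IsSlim (Dα α)` and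
`IsOfFSMType (Dα α)` (bookkeeping). [cite: MochizukiEtTh2009, Ex 3.9 p.85] -/
theorem isSlim_and_isOfFSMType_of_example39_iv_facts {VD : FrdICatStub.{max u v, v, w} (Dα α)}
    (h : E.FrobenioidHyp α VD) (hf : E.Example39_iv_facts α h) :
    IsSlim (Dα α) ∧ IsOfFSMType (Dα α) :=
  ⟨hf.2.1, hf.2.2⟩

/-- **The hypothesis structure `FrobenioidHyp` of Example 3.9 (iv) with its categorical fields supplied**:
`D_α` is connected (outright) and totally epimorphic (from `D_W`); the divisorial-monoid fields —
`Φ_α^ell` divisorial on `D_α`, (a) `Φ^{bs-fld}` monoprime, (b) nonzero constants — remain the inputs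
(they use the structure of the universal combinatorial coverings, pp.310–311 (PDF pp.84–85)).
[cite: MochizukiEtTh2009, Ex 3.9 p.85] -/
theorem frobenioidHyp_of (hW : IsTotallyEpimorphic DW) (VD : FrdICatStub.{max u v, v, w} (Dα α))
    (hdiv : VD.IsDivisorialOn (E.Φα α).toFunctor)
    (hmono : ∀ X : (Dα α)ᵒᵖ, IsMonoprime
      ↥((E.Φα α).carrier X ⊓
        (TW.cnstR (op ((toDW α).obj (unop X)))).toSubmonoid.comap Algebra.GrothendieckGroup.of))
    (hcnst : ∀ X : (Dα α)ᵒᵖ, ∃ b ∈ TW.FΛ (op ((toDW α).obj (unop X))),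
      ∃ x ∈ (E.Φα α).carrier X, ∃ y ∈ (E.Φα α).carrier X, x ≠ y ∧
        TW.divΛ _ b = Algebra.GrothendieckGroup.of x / Algebra.GrothendieckGroup.of y) :
    E.FrobenioidHyp α VD where
  isConnected := isConnected_Dα α
  isTotallyEpimorphic := isTotallyEpimorphic_Dα α hW
  isDivisorialOn := hdiv
  isMonoprime_bsFld := hmono
  exists_FΛ_div_ne := hcnst

end Example39Data

end Literature.AnabelianGeometry.EtaleTheta
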